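import Summits.QuantumFields.YangMills.Theorems.FluctuationComparisonRegPrIntLS2BetaWindowExactnessOfTower
import HarnessLib

/-!
# S2α′ · `ClassicalPerHeight` from EXW∘ — FILE 1∕3: BOOKKEEPING AND ARITHMETIC (good histories as descended data and their inheritance under one-step descent ∕ exact lift;
# the analysis-free end «summable uniform step control ⇒ 4-point null profile»; the log factor of (9) against one power of `L`; `β_K × defect` at FIXED height)

Cell `ym3-torus` (HUMAN RULING D-0037; rung R3 = continuum `SU(2)` Yang–Mills on the three-torus at fixed lattice data — NOT d = 4, NOT infinite volume, NOT a mass gap,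
NOT Clay).  Width seat `ym3-torus-px17` (gen 18); crux `stmt-QuantumFields-20520`; `--kind proof --supports stmt-QuantumFields-20520 --as helper`, count-neutral;
DEFINITION-FREE (0 `def`, 0 `instance`, 0 `notation`, 0 `sorry`, default heartbeats).  The story, the statement and the honest scope are in FILE 3∕3
`…ClassicalPerHeightOfWindowExactness` (S2α′ = `stub_classicalPerHeight` of `Cruxes/FluctuationComparisonRegPrIntL/Lines/runpair_organ.lean` v18.2 :689 ⟸ EXW∘ =
`stub_windowExactness` of `Lines/semiclassical_s2beta.lean` v11.4 :1381, by kernel; outright at `L ≥ 5`).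

WHAT IS PROVED HERE (namespace `Summit.QuantumFields.YangMills.Theorems.FluctuationComparisonRegPrIntLClassicalPerHeightSteps`; sorry-free, axioms standard).
* §0 `histGood_iff_descendTo`, `histGood_descendTo_succ`, `histGood_of_lift_succ` (history inheritance), `θBal_mono_p` (monotone in `p₀`).
* §1 `abs_sub_le_tsum_of_steps`, `fourPoint_profile_of_steps` — a summable uniform control `ρ` of consecutive differences of `K ↦ g_K` on a set gives `A n := 4·Σ_{k≥n} ρ_k ≥ 0`,
  `A → 0`, bounding every second difference of `g_K − g_{K′}` over four points of the set by `A (K − J)`.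
* §2 `succ_mul_inv_pow_le_one` (`(k+1)L^{−k} ≤ 1`), `succ_mul_inv_pow_three_le`, `inv_pow_two_mul_le_sqrt_pow_succ`, `defect_log_le`, `beta_mul_scale_upper∕lower`
  (`β_{J+k}·x^{5k}·L^{3(m+J+k)} = c·L^{3m}L^{4J}∕γ·x^k`), `defect_nonneg`, `abs_sub_le_of_two_sided`.

HONEST.  Bookkeeping ∕ arithmetic ∕ compositions BY NAME of landed theorems; nothing of Bałaban's analysis is added; `stub_classicalPerHeight`, S2β, crux 20520, 19936, 19200 and
`YM3TorusSU2` are NOT proved here; rung R3 = SU(2) YM₃ on T³ at fixed lattice data — NOT d = 4, NOT infinite volume, NOT a mass gap, NOT Clay; the Yang–Mills mass gap is NOT proved.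

References: T. Bałaban, CMP **102** (1985) 277–309 [Balaban1985Variational] (Thm 1 (6)–(10) pp.278–279, Prop. 8 p.304); CMP **102** (1985) 255–275 [Balaban1985UV3] ((3), (5) p.256,
(7) p.257, (41) p.266); CMP **98** (1985) 17–51 [Balaban1985Averaging] (Props 3–4, (125) p.36); C. King, CMP **102** (1986) 649–677 [King1986] ((A.5) p.676); P. Federbush,
CMP **110** (1987) 293–309 [Federbush1987PhaseCellIII] (Thm 4.3 (4.5) p.299).
-/

set_option autoImplicit false

noncomputable section

namespace Summit.QuantumFields.YangMills.Theorems.FluctuationComparisonRegPrIntLClassicalPerHeightSteps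

open MeasureTheory Filter Topology
open scoped Matrix.Norms.L2Operator BigOperators
open Literature.MathematicalPhysics.QuantumFieldTheory.Balaban1983to89
open Literature.MathematicalPhysics.QuantumFieldTheory.Balaban1983to89.T3ContinuumYM3Torus
open Literature.MathematicalPhysics.QuantumFieldTheory.Balaban1983to89.T3UnitLawDensityEML (ℰp)
open Literature.MathematicalPhysics.QuantumFieldTheory.Balaban1983to89.T3UnitScaleTilt
open Literature.MathematicalPhysics.QuantumFieldTheory.Balaban1983to89.T3TiltDescent
open Literature.MathematicalPhysics.QuantumFieldTheory.Balaban1983to89.T3CruxEstimates (plaqSmall_fieldShift)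
open Literature.MathematicalPhysics.QuantumFieldTheory.Balaban1983to89.T3ConstrainedMinimiser (fibre)
open Literature.MathematicalPhysics.QuantumFieldTheory.Balaban1983to89.T3DescentFibreTower
open Literature.MathematicalPhysics.QuantumFieldTheory.Balaban1983to89.T3RegularMinimiser
open Literature.MathematicalPhysics.QuantumFieldTheory.Balaban1983to89.T3PrintedRegularMinimiser
open Literature.MathematicalPhysics.QuantumFieldTheory.Balaban1983to89.T3ThresholdSmallness (sqrt_coupling_pos_le)
open Literature.MathematicalPhysics.QuantumFieldTheory.Balaban1983to89.T3Thresholds (θBal_eq coupling_le_one)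
open Literature.MathematicalPhysics.QuantumFieldTheory.Balaban1983to89.T3LowerAlongMinimisersSplit (scheme_β_succ)
open Literature.MathematicalPhysics.QuantumFieldTheory.Balaban1983to89.T3UpperLiftSplit (scheme_β_eq defect_le)
open Literature.MathematicalPhysics.QuantumFieldTheory.Balaban1983to89.T4Continuum

/-! ## §0 Bookkeeping: good histories as descended data; history inheritance under one-step descent and one-step exact lift; `θBal` in `p₀` -/

section Histories

variable (F : T3Family)

/-- A good history read level by level (`D_{n,K}U` is `θ(n)`-small for every `J ≤ n ≤ K`; lit ✓`plaqSmall_fieldShift`). [cite: Balaban1985UV3, (7) p.257] -/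
theorem histGood_iff_descendTo {θ : ℕ → ℝ} {J K : ℕ} {U : GaugeField (F.P K) 0 (Matrix.specialUnitaryGroup (Fin 2) ℂ)} :
    U ∈ histGood F ℰp θ K J ↔ ∀ (n : ℕ) (_ : J ≤ n) (hnK : n ≤ K), PlaqSmall (θ n) (descendTo F ℰp n K hnK U) := by
  constructor
  · intro hU n hJn hnK
    have h := hU (K - n) (by omega)
    rw [show K - (K - n) = n by omega] at h
    exact (plaqSmall_fieldShift F _ (θ n) _).mpr h
  · intro h j hj
    have hd := h (K - j) (by omega) (by omega)
    have h' := (plaqSmall_fieldShift F _ (θ (K - j)) _).mp hd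
    rwa [show K - (K - j) = j by omega] at h'

/-- History inheritance under one-step descent: the one-step average of a good history of run `K+1` is a good history of run `K` (lit ✓`descendTo_descendTo`). [cite: Balaban1987RG1, (0.11) p.253] -/
theorem histGood_descendTo_succ {θ : ℕ → ℝ} {J K : ℕ} {U' : GaugeField (F.P (K + 1)) 0 (Matrix.specialUnitaryGroup (Fin 2) ℂ)}
    (hU' : U' ∈ histGood F ℰp θ (K + 1) J) :
    descendTo F ℰp K (K + 1) (Nat.le_succ K) U' ∈ histGood F ℰp θ K J := by
  rw [histGood_iff_descendTo] at hU' ⊢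
  intro n hJn hnK
  rw [descendTo_descendTo]
  exact hU' n hJn (hnK.trans (Nat.le_succ K))

/-- History inheritance under an exact one-step lift: a lift of a good history of run `K` whose own plaquettes meet the top window is a good history of run `K+1`. [cite: Balaban1985UV3, (7) p.257] -/
theorem histGood_of_lift_succ {θ : ℕ → ℝ} {J K : ℕ} {U : GaugeField (F.P K) 0 (Matrix.specialUnitaryGroup (Fin 2) ℂ)}
    {U'' : GaugeField (F.P (K + 1)) 0 (Matrix.specialUnitaryGroup (Fin 2) ℂ)}
    (hlift : descendTo F ℰp K (K + 1) (Nat.le_succ K) U'' = U) (hU : U ∈ histGood F ℰp θ K J) (htop : PlaqSmall (θ (K + 1)) U'') :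
    U'' ∈ histGood F ℰp θ (K + 1) J := by
  rw [histGood_iff_descendTo] at hU ⊢
  intro n hJn hnK1
  rcases Nat.lt_or_ge K n with hlt | hle
  · have hn : n = K + 1 := by omega
    subst hn
    rw [descendTo_self]
    exact htop
  · rw [← descendTo_descendTo F ℰp hle (Nat.le_succ K), hlift]
    exact hU n hJn hle

/-- `θBal` is monotone in the profile exponent `p₀` (the base `1 + log g⁻¹ ≥ 1` for `g ≤ 1`). [cite: Balaban1985UV3, (7) p.257] -/
theorem θBal_mono_p {L : ℕ} (hL : 1 ≤ L) {γ : ℝ} (hγ : 0 < γ) (hγ1 : γ ≤ 1) {b₀ : ℝ} (hb : 0 ≤ b₀) {p p' : ℝ} (hpp : p ≤ p') (i : ℕ) :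
    θBal L γ b₀ p i ≤ θBal L γ b₀ p' i := by
  rw [θBal_eq, θBal_eq]
  have hg := sqrt_coupling_pos_le hL hγ i
  have hg1 := coupling_le_one hL hγ hγ1 i
  refine mul_le_mul_of_nonneg_left ?_ hg.1.le
  unfold B10.pFun
  refine mul_le_mul_of_nonneg_left ?_ hb
  have hbase : (1 : ℝ) ≤ 1 + Real.log (Real.sqrt (γ * ((L : ℝ)⁻¹) ^ i))⁻¹ := by
    have := B10.log_inv_nonneg_of_le_one hg.1 hg1
    linarith
  exact Real.rpow_le_rpow_of_exponent_le hbase hpp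

end Histories

/-! ## §1 The analysis-free end: a summable control of consecutive differences, uniform on a set, gives the 4-point null profile -/

section FourPoint

variable {X : Type*}

/-- Telescoping under a summable uniform control of consecutive differences: `|g_K − g_{K′}| ≤ Σ_{k ≥ K−J} ρ_k` on the set. [folklore] -/
theorem abs_sub_le_tsum_of_steps (g : ℕ → X → ℝ) (W : Set X) (J : ℕ) {ρ : ℕ → ℝ} (hρ : Summable ρ) (hρ0 : ∀ k, 0 ≤ ρ k)
    (hstep : ∀ k, ∀ V ∈ W, |g (J + k + 1) V - g (J + k) V| ≤ ρ k) {K K' : ℕ} (hJK : J ≤ K) (hKK' : K ≤ K') {V : X} (hV : V ∈ W) :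
    |g K V - g K' V| ≤ ∑' i, ρ (i + (K - J)) := by
  have hρ' : Summable (fun i => ρ (i + (K - J))) := (summable_nat_add_iff (K - J)).mpr hρ
  -- telescope over `i < K' − K`
  have htel : g K' V - g K V = ∑ i ∈ Finset.range (K' - K), (g (K + (i + 1)) V - g (K + i) V) := by
    have h := Finset.sum_range_sub (fun i => g (K + i) V) (K' - K)
    rw [h, show K + (K' - K) = K' by omega, Nat.add_zero]
  rw [abs_sub_comm, htel]
  refine (Finset.abs_sum_le_sum_abs _ _).trans ?_
  calc ∑ i ∈ Finset.range (K' - K), |g (K + (i + 1)) V - g (K + i) V|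
      ≤ ∑ i ∈ Finset.range (K' - K), ρ (i + (K - J)) := by
        refine Finset.sum_le_sum fun i _ => ?_
        have h := hstep (K - J + i) V hV
        have e1 : J + (K - J + i) + 1 = K + (i + 1) := by omega
        have e2 : J + (K - J + i) = K + i := by omega
        rw [e1, e2] at h
        rw [show i + (K - J) = K - J + i by omega]
        exact h
    _ ≤ ∑' i, ρ (i + (K - J)) := hρ'.sum_le_tsum _ (fun i _ => hρ0 _)

/-- The 4-point null profile from the summable uniform step control: `A n := 4·Σ_{k ≥ n} ρ_k ≥ 0`, `A → 0` (`tendsto_sum_nat_add`), and every window quadrilateral's second difference of `g_K − g_{K′}` is below `A (K − J)`. [folklore] -/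
theorem fourPoint_profile_of_steps (g : ℕ → X → ℝ) (S : Set X) (J : ℕ) {ρ : ℕ → ℝ} (hρ : Summable ρ) (hρ0 : ∀ k, 0 ≤ ρ k)
    (hstep : ∀ k, ∀ V ∈ S, |g (J + k + 1) V - g (J + k) V| ≤ ρ k) :
    ∃ A : ℕ → ℝ, (∀ n, 0 ≤ A n) ∧ Tendsto A atTop (𝓝 0) ∧
      ∀ (K K' : ℕ), J ≤ K → K ≤ K' → ∀ (U V W Z : X), U ∈ S → V ∈ S → W ∈ S → Z ∈ S →
        |(g K U - g K' U) - (g K V - g K' V) - ((g K W - g K' W) - (g K Z - g K' Z))| ≤ A (K - J) := by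
  refine ⟨fun n => 4 * ∑' i, ρ (i + n), fun n => ?_, ?_, fun K K' hJK hKK' U V W Z hU hV hW hZ => ?_⟩
  · exact mul_nonneg (by norm_num) (tsum_nonneg fun i => hρ0 _)
  · have h := (tendsto_sum_nat_add ρ).const_mul (4 : ℝ)
    rwa [mul_zero] at h
  · have hU' := abs_sub_le_tsum_of_steps g S J hρ hρ0 hstep hJK hKK' hU
    have hV' := abs_sub_le_tsum_of_steps g S J hρ hρ0 hstep hJK hKK' hV
    have hW' := abs_sub_le_tsum_of_steps g S J hρ hρ0 hstep hJK hKK' hW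
    have hZ' := abs_sub_le_tsum_of_steps g S J hρ hρ0 hstep hJK hKK' hZ
    have h1 := abs_sub (g K U - g K' U) (g K V - g K' V)
    have h2 := abs_sub (g K W - g K' W) (g K Z - g K' Z)
    have h3 := abs_sub ((g K U - g K' U) - (g K V - g K' V)) ((g K W - g K' W) - (g K Z - g K' Z))
    linarith

end FourPoint

/-! ## §2 Arithmetic: the log factor against one power of `L`, the defect along (8) ∧ log-(9), and `β_K × defect` at FIXED height -/

section Arithmetic

variable (F : T3Family)

/-- `(k + 1)·(L⁻¹)^k ≤ 1` for `L ≥ 2` — the log-Lipschitz factor of (9) against one power of `L`. [folklore] -/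
theorem succ_mul_inv_pow_le_one (k : ℕ) : ((k : ℝ) + 1) * ((F.L : ℝ)⁻¹) ^ k ≤ 1 := by
  have hL2 : (2 : ℝ) ≤ F.L := by have := F.hL.2; exact_mod_cast this
  have hL0 : (0 : ℝ) < F.L := by linarith
  have hk : (k : ℝ) + 1 ≤ (2 : ℝ) ^ k := by
    have h := Nat.lt_two_pow_self (n := k)
    exact_mod_cast h
  have h2k : (2 : ℝ) ^ k ≤ (F.L : ℝ) ^ k := pow_le_pow_left₀ (by norm_num) hL2 k
  rw [inv_pow]
  rw [mul_inv_le_iff₀ (pow_pos hL0 k), one_mul]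
  exact hk.trans h2k

/-- `(k + 1)·(L⁻¹)^{3k} ≤ (L⁻¹)^{2k}`. [folklore] -/
theorem succ_mul_inv_pow_three_le (k : ℕ) : ((k : ℝ) + 1) * ((F.L : ℝ)⁻¹) ^ (3 * k) ≤ ((F.L : ℝ)⁻¹) ^ (2 * k) := by
  have hx : (0 : ℝ) ≤ ((F.L : ℝ)⁻¹) := inv_nonneg.mpr (Nat.cast_nonneg _)
  have h := succ_mul_inv_pow_le_one F k
  calc ((k : ℝ) + 1) * ((F.L : ℝ)⁻¹) ^ (3 * k) = (((k : ℝ) + 1) * ((F.L : ℝ)⁻¹) ^ k) * ((F.L : ℝ)⁻¹) ^ (2 * k) := by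
        rw [show 3 * k = k + 2 * k by ring, pow_add]; ring
    _ ≤ 1 * ((F.L : ℝ)⁻¹) ^ (2 * k) := mul_le_mul_of_nonneg_right h (pow_nonneg hx _)
    _ = ((F.L : ℝ)⁻¹) ^ (2 * k) := one_mul _

/-- `(L⁻¹)^{2k} ≤ (√(L⁻¹))^{k+1}` for `k ≥ 1` — the lift's `L^{−2}` per level against the window's `L^{−1∕2}` per level. [folklore] -/
theorem inv_pow_two_mul_le_sqrt_pow_succ {k : ℕ} (hk : 1 ≤ k) :
    ((F.L : ℝ)⁻¹) ^ (2 * k) ≤ (Real.sqrt ((F.L : ℝ)⁻¹)) ^ (k + 1) := by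
  set x : ℝ := (F.L : ℝ)⁻¹ with hx_def
  have hx0 : 0 ≤ x := inv_nonneg.mpr (Nat.cast_nonneg _)
  have hx1 : x ≤ 1 := inv_le_one_of_one_le₀ (by have := F.hL.2; exact_mod_cast (by omega : 1 ≤ F.L))
  have hs0 : 0 ≤ Real.sqrt x := Real.sqrt_nonneg _
  have hs1 : Real.sqrt x ≤ 1 := Real.sqrt_le_one.mpr hx1
  have hsq : (Real.sqrt x) ^ (4 * k) = x ^ (2 * k) := by
    rw [show 4 * k = 2 * (2 * k) by ring, pow_mul, Real.sq_sqrt hx0]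
  rw [← hsq]
  exact pow_le_pow_of_le_one hs0 hs1 (by omega)

/-- The defect along (8) ∧ log-(9): with `a = B₃θx^{2k}`, `b = B₄θ(k+1)x^{3k}`, `0 ≤ θ ≤ 1`, `B₃, B₄, C ≥ 0`:
`C(b² + ab + a³) ≤ C(B₄² + B₃B₄ + B₃³)·(k+1)²·θ²·x^{5k}` (lit ✓`defect_le` at `B₄ ↦ B₄(k+1)`). [cite: Balaban1985Variational, Thm 1 (8)-(10) p.279] -/
theorem defect_log_le {B₃ B₄ C θ : ℝ} (hB₃ : 0 ≤ B₃) (hB₄ : 0 ≤ B₄) (hC : 0 ≤ C) (hθ1 : θ ≤ 1) (k : ℕ) :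
    C * ((B₄ * θ * ((k : ℝ) + 1) * ((F.L : ℝ)⁻¹) ^ (3 * k)) ^ 2 +
        (B₃ * θ * ((F.L : ℝ)⁻¹) ^ (2 * k)) * (B₄ * θ * ((k : ℝ) + 1) * ((F.L : ℝ)⁻¹) ^ (3 * k)) +
        (B₃ * θ * ((F.L : ℝ)⁻¹) ^ (2 * k)) ^ 3) ≤
      C * (B₄ ^ 2 + B₃ * B₄ + B₃ ^ 3) * ((k : ℝ) + 1) ^ 2 * θ ^ 2 * ((F.L : ℝ)⁻¹) ^ (5 * k) := by
  have h := defect_le F (B₄ := B₄ * ((k : ℝ) + 1)) (C₂ := C) hB₃ hC hθ1 k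
  have hk1 : (1 : ℝ) ≤ (k : ℝ) + 1 := by have := Nat.cast_nonneg (α := ℝ) k; linarith
  have hk2 : (1 : ℝ) ≤ ((k : ℝ) + 1) ^ 2 := one_le_pow₀ hk1
  have hx5 : (0 : ℝ) ≤ ((F.L : ℝ)⁻¹) ^ (5 * k) := pow_nonneg (inv_nonneg.mpr (Nat.cast_nonneg _)) _
  have hM : (B₄ * ((k : ℝ) + 1)) ^ 2 + B₃ * (B₄ * ((k : ℝ) + 1)) + B₃ ^ 3 ≤ (B₄ ^ 2 + B₃ * B₄ + B₃ ^ 3) * ((k : ℝ) + 1) ^ 2 := by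
    have h1 : B₃ * (B₄ * ((k : ℝ) + 1)) ≤ B₃ * B₄ * ((k : ℝ) + 1) ^ 2 := by
      rw [← mul_assoc]
      exact mul_le_mul_of_nonneg_left (by nlinarith) (mul_nonneg hB₃ hB₄)
    have h3 : B₃ ^ 3 ≤ B₃ ^ 3 * ((k : ℝ) + 1) ^ 2 := le_mul_of_one_le_right (pow_nonneg hB₃ 3) hk2
    nlinarith
  calc C * ((B₄ * θ * ((k : ℝ) + 1) * ((F.L : ℝ)⁻¹) ^ (3 * k)) ^ 2 +
        (B₃ * θ * ((F.L : ℝ)⁻¹) ^ (2 * k)) * (B₄ * θ * ((k : ℝ) + 1) * ((F.L : ℝ)⁻¹) ^ (3 * k)) +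
        (B₃ * θ * ((F.L : ℝ)⁻¹) ^ (2 * k)) ^ 3)
      = C * (((B₄ * ((k : ℝ) + 1)) * θ * ((F.L : ℝ)⁻¹) ^ (3 * k)) ^ 2 +
        (B₃ * θ * ((F.L : ℝ)⁻¹) ^ (2 * k)) * ((B₄ * ((k : ℝ) + 1)) * θ * ((F.L : ℝ)⁻¹) ^ (3 * k)) +
        (B₃ * θ * ((F.L : ℝ)⁻¹) ^ (2 * k)) ^ 3) := by ring
    _ ≤ C * ((B₄ * ((k : ℝ) + 1)) ^ 2 + B₃ * (B₄ * ((k : ℝ) + 1)) + B₃ ^ 3) * θ ^ 2 * ((F.L : ℝ)⁻¹) ^ (5 * k) := h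
    _ ≤ C * ((B₄ ^ 2 + B₃ * B₄ + B₃ ^ 3) * ((k : ℝ) + 1) ^ 2) * θ ^ 2 * ((F.L : ℝ)⁻¹) ^ (5 * k) := by
        have : 0 ≤ C * θ ^ 2 * ((F.L : ℝ)⁻¹) ^ (5 * k) := by positivity
        nlinarith
    _ = C * (B₄ ^ 2 + B₃ * B₄ + B₃ ^ 3) * ((k : ℝ) + 1) ^ 2 * θ ^ 2 * ((F.L : ℝ)⁻¹) ^ (5 * k) := by ring

/-- `β_{J+k} × (c·x^{5k}·L^{3(m+J+k)}) = (c·L^{3m}·L^{4J}/γ)·x^k` (`β_K = L^K∕γ`): at FIXED height the UPPER radius is geometric in the depth. [cite: Balaban1985UV3, (3) and (5) p.256] -/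
theorem beta_mul_scale_upper (γ c : ℝ) (J k : ℕ) :
    (F.scheme ℰp γ).β (J + k) * (c * ((F.L : ℝ)⁻¹) ^ (5 * k) * (F.L : ℝ) ^ (3 * (F.m + (J + k)))) =
      (c * (F.L : ℝ) ^ (3 * F.m) * (F.L : ℝ) ^ (4 * J) / γ) * ((F.L : ℝ)⁻¹) ^ k := by
  have hL0 : (0 : ℝ) < F.L := by have := F.hL.2; exact_mod_cast (by omega : 0 < F.L)
  rw [scheme_β_eq]
  simp only [inv_pow, mul_inv]
  have hLk : (F.L : ℝ) ^ k ≠ 0 := pow_ne_zero _ hL0.ne'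
  field_simp
  ring

/-- `β_{J+k} × (c·x^{5(k+1)}·L^{3(m+(J+k+1))}) = (c·L^{3m}·L^{4J}/γ)·x^{k+2}`: the LOWER radius at fixed height. [cite: Balaban1985UV3, (3) and (5) p.256] -/
theorem beta_mul_scale_lower (γ c : ℝ) (J k : ℕ) :
    (F.scheme ℰp γ).β (J + k) * (c * ((F.L : ℝ)⁻¹) ^ (5 * (k + 1)) * (F.L : ℝ) ^ (3 * (F.m + (J + k + 1)))) =
      (c * (F.L : ℝ) ^ (3 * F.m) * (F.L : ℝ) ^ (4 * J) / γ) * ((F.L : ℝ)⁻¹) ^ (k + 2) := by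
  have hL0 : (0 : ℝ) < F.L := by have := F.hL.2; exact_mod_cast (by omega : 0 < F.L)
  rw [scheme_β_eq]
  simp only [inv_pow, mul_inv]
  have hLk : (F.L : ℝ) ^ k ≠ 0 := pow_ne_zero _ hL0.ne'
  field_simp
  ring

/-- The defect expression is nonnegative (local helper, kept out of the large contexts below). [folklore] -/
theorem defect_nonneg {B₃ B₄ C θ β y : ℝ} (hB₃ : 0 ≤ B₃) (hB₄ : 0 ≤ B₄) (hC : 0 ≤ C) (hθ : 0 ≤ θ) (hβ : 0 ≤ β) (hy : 0 ≤ y) (k j : ℕ) :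
    0 ≤ β * (C * ((B₄ * θ * ((k : ℝ) + 1) * ((F.L : ℝ)⁻¹) ^ (3 * j)) ^ 2 +
        (B₃ * θ * ((F.L : ℝ)⁻¹) ^ (2 * j)) * (B₄ * θ * ((k : ℝ) + 1) * ((F.L : ℝ)⁻¹) ^ (3 * j)) +
        (B₃ * θ * ((F.L : ℝ)⁻¹) ^ (2 * j)) ^ 3) * y) := by
  have hx : (0 : ℝ) ≤ (F.L : ℝ)⁻¹ := inv_nonneg.mpr (Nat.cast_nonneg _)
  positivity

/-- Two one-sided step bounds with nonnegative defects and a radius give the absolute step bound (local helper). [folklore] -/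
theorem abs_sub_le_of_two_sided {g₀ g₁ dU dL R : ℝ} (hup : g₁ ≤ g₀ + dU) (hlow : g₀ ≤ g₁ + dL) (hrad : dU + dL ≤ R)
    (hdU : 0 ≤ dU) (hdL : 0 ≤ dL) : |g₁ - g₀| ≤ R := by
  rw [abs_le]
  constructor <;> linarith

end Arithmetic

end Summit.QuantumFields.YangMills.Theorems.FluctuationComparisonRegPrIntLClassicalPerHeightSteps

end
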